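import Mathlib.Analysis.Calculus.DifferentialForm.Basic
import Mathlib.Analysis.Calculus.ParametricIntervalIntegral
import Mathlib.MeasureTheory.Integral.IntervalIntegral.FundThmCalculus
import Mathlib.Analysis.Normed.Module.Alternating.Curry
import Mathlib.Analysis.Calculus.FDeriv.CompCLM
import Mathlib.Analysis.Calculus.FDeriv.Bilinear
import HarnessLib

/-!
# The cone (Poincaré) homotopy operator for differential forms on star-shaped open sets

Topic `Analysis/Calculus`; namespace `Literature.Analysis.Calculus`.  Definitions with bodies and
theorems; no named fact, no `sorry`.

For a differential `(n+1)`-form `ω : E → E [⋀^Fin (n+1)]→L[ℝ] F` (Mathlib's `extDeriv`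
formalism) and a base point `x₀`, the **cone operator**

  `(h ω)(y)(v₁, …, vₙ) = ∫₀¹ tⁿ ω(x₀ + t (y - x₀)) (y - x₀, v₁, …, vₙ) dt`     (`conePrimitive`)

is the standard chain homotopy of the Poincaré lemma: on an open set `X`, star-shaped with respect
to `x₀`, for `ω` of class `C¹` on `X`,

  `d (h ω) + h (d ω) = ω`      (`extDeriv_conePrimitive_add_conePrimitive_extDeriv_apply`),

so a CLOSED form is EXACT with the explicit primitive `h ω` (`extDeriv_conePrimitive_of_closed`),
which moreover satisfies the sup bound `‖(h ω)(y)‖ ≤ ‖y - x₀‖ · sup_{[x₀,y]} ‖ω‖`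
(`norm_conePrimitive_le`) — the estimate that makes `h` preserve polynomial growth conditions.
The derivative of `h ω` is computed by differentiation under the integral sign
(`hasFDerivAt_conePrimitive`, stated with an explicit local bound on `ω` and `Dω` over the cone on
a ball, as holds for `C¹` forms on finite-dimensional `E`), the identity itself is the computation
`d(hω) + h(dω) = ∫₀¹ d/dt [t^{n+1} ω(x_t)] dt` ([Spivak 1965, Thm. 4-11]; [Bott–Tu 1982, I §4]).  This is brick B1 of the growth-tracked van Est staircase for Borel's
regularization theorem (`Literature/NumberTheory/Automorphic/ResGLnCuspidalCohomologyUmg.lean`).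

[cite: Spivak1965, Thm. 4-11] [cite: BottTu1982, I §4]

## References

* M. Spivak, *Calculus on Manifolds*, Benjamin (1965), Thm. 4-11 (Poincaré lemma, cone homotopy).
  [Spivak1965]
* R. Bott, L. W. Tu, *Differential Forms in Algebraic Topology*, GTM 82 (1982), I §4. [BottTu1982]
-/

noncomputable section

open Set MeasureTheory intervalIntegral Filter Topology
open scoped Interval

namespace Literature.Analysis.Calculus

variable {E F : Type*} [NormedAddCommGroup E] [NormedSpace ℝ E] [NormedAddCommGroup F] [NormedSpace ℝ F]
  {n : ℕ}

/-! ### Segments from the base point -/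

/-- The point `x₀ + t (y - x₀)` of the segment from `x₀` to `y`. [folklore] -/
def conePt (x₀ y : E) (t : ℝ) : E := x₀ + t • (y - x₀)

/-- The segment starts at `x₀`. [folklore] -/
@[simp] theorem conePt_zero (x₀ y : E) : conePt x₀ y 0 = x₀ := by simp [conePt]

/-- The segment ends at `y`. [folklore] -/
@[simp] theorem conePt_one (x₀ y : E) : conePt x₀ y 1 = y := by simp [conePt]

/-- `t ↦ x₀ + t (y - x₀)` has derivative `y - x₀`. [folklore] -/
theorem hasDerivAt_conePt (x₀ y : E) (t : ℝ) : HasDerivAt (conePt x₀ y) (y - x₀) t := by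
  have h : HasDerivAt (fun s : ℝ => x₀ + s • (y - x₀)) ((1 : ℝ) • (y - x₀)) t :=
    ((hasDerivAt_id t).smul_const (y - x₀)).const_add x₀
  rw [one_smul] at h
  exact h

/-- The segment is continuous in `t`. [folklore] -/
theorem continuous_conePt (x₀ y : E) : Continuous (conePt x₀ y) :=
  continuous_const.add (continuous_id.smul continuous_const)

/-- `y ↦ x₀ + t (y - x₀)` has derivative `t · id`. [folklore] -/
theorem hasFDerivAt_conePt_right (x₀ : E) (t : ℝ) (y : E) :
    HasFDerivAt (fun y' => conePt x₀ y' t) (t • ContinuousLinearMap.id ℝ E) y := by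
  have h : HasFDerivAt (fun y' : E => x₀ + t • (y' - x₀)) (t • ContinuousLinearMap.id ℝ E) y :=
    (((hasFDerivAt_id y).sub_const x₀).const_smul t).const_add x₀
  exact h

/-- On a set star-shaped with respect to `x₀`, the segment `[x₀, y]` of a point `y` of the set
stays in the set. [folklore] -/
theorem conePt_mem {x₀ y : E} {X : Set E} (hX : StarConvex ℝ x₀ X) (hy : y ∈ X) {t : ℝ}
    (ht : t ∈ Icc (0 : ℝ) 1) : conePt x₀ y t ∈ X := by
  have h := hX hy (sub_nonneg.2 ht.2) ht.1 (sub_add_cancel 1 t)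
  convert h using 1
  simp only [conePt, smul_sub, sub_smul, one_smul]
  abel

/-- Continuity of a form along a segment inside its domain of continuity. [folklore] -/
theorem continuousOn_comp_conePt {G : Type*} [TopologicalSpace G] {ω : E → G} {X : Set E}
    (hc : ContinuousOn ω X) {x₀ y : E} (hX : StarConvex ℝ x₀ X) (hy : y ∈ X) :
    ContinuousOn (fun t => ω (conePt x₀ y t)) (Icc 0 1) :=
  hc.comp (continuous_conePt x₀ y).continuousOn fun _ ht => conePt_mem hX hy ht

/-! ### Currying the first argument, as a continuous linear map -/

variable (n F) in
/-- `f ↦ f.curryLeft`, as a continuous linear map (Mathlib's `curryLeftLI`). [folklore] -/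
def curryLeftCLM : (E [⋀^Fin (n + 1)]→L[ℝ] F) →L[ℝ] (E →L[ℝ] E [⋀^Fin n]→L[ℝ] F) :=
  (ContinuousAlternatingMap.curryLeftLI (𝕜 := ℝ) (E := E) (F := F) (n := n)).toContinuousLinearMap

/-- Unfolding. [folklore] -/
@[simp] theorem curryLeftCLM_apply (f : E [⋀^Fin (n + 1)]→L[ℝ] F) : curryLeftCLM F n f = f.curryLeft := rfl

/-- `‖f.curryLeft u‖ ≤ ‖f‖ ‖u‖`. [folklore] -/
theorem norm_curryLeft_apply_le (f : E [⋀^Fin (n + 1)]→L[ℝ] F) (u : E) : ‖f.curryLeft u‖ ≤ ‖f‖ * ‖u‖ := by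
  simpa using (f.curryLeft).le_opNorm u

/-- `ℤ`-signs versus real signs. [folklore] -/
theorem negOnePow_zsmul_eq {G : Type*} [AddCommGroup G] [Module ℝ G] (k : ℕ) (x : G) :
    ((-1 : ℤ) ^ k) • x = ((-1 : ℝ) ^ k) • x := by
  rw [← Int.cast_smul_eq_zsmul ℝ]
  push_cast
  rfl

/-! ### The cone operator -/

/-- **The cone (Poincaré) homotopy operator** with base point `x₀`:
`(h ω)(y) = ∫₀¹ tⁿ · ω(x₀ + t(y - x₀))(y - x₀, …) dt`, an `n`-form for an `(n+1)`-form `ω`.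
[cite: Spivak1965, Thm. 4-11] -/
def conePrimitive (x₀ : E) (ω : E → E [⋀^Fin (n + 1)]→L[ℝ] F) (y : E) : E [⋀^Fin n]→L[ℝ] F :=
  ∫ t in (0 : ℝ)..1, (t ^ n) • (ω (conePt x₀ y t)).curryLeft (y - x₀)

variable [CompleteSpace F]

omit [CompleteSpace F] in
/-- Interval integrability of the integrand of the cone operator. [folklore] -/
theorem intervalIntegrable_conePrimitive {ω : E → E [⋀^Fin (n + 1)]→L[ℝ] F} {X : Set E}
    (hc : ContinuousOn ω X) {x₀ y : E} (hX : StarConvex ℝ x₀ X) (hy : y ∈ X) :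
    IntervalIntegrable (fun t : ℝ => (t ^ n) • (ω (conePt x₀ y t)).curryLeft (y - x₀)) volume 0 1 := by
  refine ContinuousOn.intervalIntegrable ?_
  rw [uIcc_of_le zero_le_one]
  refine (continuousOn_pow n).smul ?_
  have h1 : ContinuousOn (fun t => curryLeftCLM F n (ω (conePt x₀ y t)) (y - x₀)) (Icc 0 1) :=
    ((curryLeftCLM F n).continuous.comp_continuousOn (continuousOn_comp_conePt hc hX hy)).clm_apply
      continuousOn_const
  simpa using h1

/-- **Evaluation of the cone operator**: `(h ω)(y)(v) = ∫₀¹ tⁿ ω(x₀ + t(y-x₀))(y - x₀, v) dt`.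
[cite: Spivak1965, Thm. 4-11] -/
theorem conePrimitive_apply {ω : E → E [⋀^Fin (n + 1)]→L[ℝ] F} {X : Set E} (hc : ContinuousOn ω X)
    {x₀ y : E} (hX : StarConvex ℝ x₀ X) (hy : y ∈ X) (v : Fin n → E) :
    conePrimitive x₀ ω y v = ∫ t in (0 : ℝ)..1, (t ^ n) • ω (conePt x₀ y t) (Matrix.vecCons (y - x₀) v) := by
  unfold conePrimitive
  rw [← ContinuousAlternatingMap.apply_apply (𝕜 := ℝ) (m := v) (c := ∫ t in (0 : ℝ)..1, _),
    ← (ContinuousAlternatingMap.apply ℝ E F v).intervalIntegral_comp_comm (intervalIntegrable_conePrimitive hc hX hy)]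
  rfl

omit [CompleteSpace F] in
/-- **Sup bound**: if `‖ω‖ ≤ C` on the segment `[x₀, y]` then `‖(h ω)(y)‖ ≤ C ‖y - x₀‖` — the cone
operator preserves polynomial growth conditions. [folklore] -/
theorem norm_conePrimitive_le {ω : E → E [⋀^Fin (n + 1)]→L[ℝ] F} {x₀ y : E} {C : ℝ}
    (hC : ∀ t ∈ Icc (0 : ℝ) 1, ‖ω (conePt x₀ y t)‖ ≤ C) :
    ‖conePrimitive x₀ ω y‖ ≤ C * ‖y - x₀‖ := by
  have h0C : 0 ≤ C := (norm_nonneg _).trans (hC 0 ⟨le_rfl, zero_le_one⟩)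
  have h := intervalIntegral.norm_integral_le_of_norm_le_const (a := (0 : ℝ)) (b := 1) (C := C * ‖y - x₀‖)
    (f := fun t : ℝ => (t ^ n) • (ω (conePt x₀ y t)).curryLeft (y - x₀)) ?_
  · simpa [conePrimitive] using h
  · intro t ht
    rw [uIoc_of_le zero_le_one] at ht
    have ht' : t ∈ Icc (0 : ℝ) 1 := ⟨ht.1.le, ht.2⟩
    calc ‖(t ^ n) • (ω (conePt x₀ y t)).curryLeft (y - x₀)‖
        = |t| ^ n * ‖(ω (conePt x₀ y t)).curryLeft (y - x₀)‖ := by rw [norm_smul, norm_pow, Real.norm_eq_abs]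
      _ ≤ 1 * (‖ω (conePt x₀ y t)‖ * ‖y - x₀‖) := by
          refine mul_le_mul ?_ (norm_curryLeft_apply_le _ _) (norm_nonneg _) zero_le_one
          exact pow_le_one₀ (abs_nonneg t) (abs_le.2 ⟨by linarith [ht.1], ht.2⟩)
      _ ≤ C * ‖y - x₀‖ := by rw [one_mul]; exact mul_le_mul_of_nonneg_right (hC t ht') (norm_nonneg _)

/-! ### Algebra of the exterior derivative in the first slot -/

omit [NormedAddCommGroup E] [NormedSpace ℝ E] [CompleteSpace F] in
/-- Removing the entry `i+1` of `(u, v)` removes the entry `i` of `v`. [folklore] -/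
private theorem removeNth_succ_vecCons (u : E) (v : Fin (n + 1) → E) (i : Fin (n + 1)) :
    Fin.removeNth i.succ (Matrix.vecCons u v) = Matrix.vecCons u (Fin.removeNth i v) := by
  funext j
  refine Fin.cases ?_ (fun k => ?_) j
  · simp [Fin.removeNth]
  · simp [Fin.removeNth, Fin.succ_succAbove_succ]

omit [NormedAddCommGroup E] [NormedSpace ℝ E] [CompleteSpace F] in
/-- Removing the entry `0` of `(u, v)` gives `v`. [folklore] -/
private theorem removeNth_zero_vecCons (u : E) (v : Fin (n + 1) → E) :
    Fin.removeNth 0 (Matrix.vecCons u v) = v := by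
  funext j; simp [Fin.removeNth]

omit [CompleteSpace F] in
/-- **`dω(x)(u, v) = Dω(x)(u)(v) - ∑ᵢ (-1)ⁱ Dω(x)(vᵢ)(u, v̂ᵢ)`** (Mathlib's normalisation of
`extDeriv`, first slot separated). [folklore] -/
theorem extDeriv_apply_vecCons {ω : E → E [⋀^Fin (n + 1)]→L[ℝ] F} {x : E} {ω' : E →L[ℝ] E [⋀^Fin (n + 1)]→L[ℝ] F}
    (h : HasFDerivAt ω ω' x) (u : E) (v : Fin (n + 1) → E) :
    extDeriv ω x (Matrix.vecCons u v) =
      ω' u v - ∑ i : Fin (n + 1), (-1 : ℝ) ^ (i : ℕ) • ω' (v i) (Matrix.vecCons u (i.removeNth v)) := by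
  rw [extDeriv, h.fderiv, ContinuousAlternatingMap.alternatizeUncurryFin_apply, Fin.sum_univ_succ]
  simp only [negOnePow_zsmul_eq, Fin.val_zero, pow_zero, one_smul, Matrix.cons_val_zero, removeNth_zero_vecCons,
    Fin.val_succ, pow_succ, Matrix.cons_val_succ, removeNth_succ_vecCons, mul_neg, mul_one, neg_smul,
    Finset.sum_neg_distrib]
  rw [sub_eq_add_neg]

omit [CompleteSpace F] in
/-- **`∑ᵢ (-1)ⁱ f(vᵢ, v̂ᵢ) = (n+1) f(v)`** for an alternating `(n+1)`-map. [folklore] -/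
theorem sum_negOnePow_smul_map_vecCons_removeNth (f : E [⋀^Fin (n + 1)]→L[ℝ] F) (v : Fin (n + 1) → E) :
    ∑ i : Fin (n + 1), (-1 : ℝ) ^ (i : ℕ) • f (Matrix.vecCons (v i) (i.removeNth v)) = ((n : ℝ) + 1) • f v := by
  have key : ∀ i : Fin (n + 1), (-1 : ℝ) ^ (i : ℕ) • f (Matrix.vecCons (v i) (i.removeNth v)) = f v := by
    intro i
    have h := f.toAlternatingMap.map_insertNth i (v i) (i.removeNth v)
    rw [Fin.insertNth_self_removeNth, negOnePow_zsmul_eq] at h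
    change f v = (-1 : ℝ) ^ (i : ℕ) • f (Matrix.vecCons (v i) (i.removeNth v)) at h
    exact h.symm
  simp only [key, Finset.sum_const, Finset.card_univ, Fintype.card_fin]
  rw [← Nat.cast_smul_eq_nsmul ℝ]
  push_cast
  rfl

/-! ### The fundamental theorem of calculus along the segment -/

omit [CompleteSpace F] in
/-- `d/dt [ω(x_t)(v)] = Dω(x_t)(y - x₀)(v)`. [folklore] -/
theorem hasDerivAt_apply_conePt {ω : E → E [⋀^Fin (n + 1)]→L[ℝ] F} {ω' : E → E →L[ℝ] E [⋀^Fin (n + 1)]→L[ℝ] F}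
    {x₀ y : E} {t : ℝ} (h : HasFDerivAt ω (ω' (conePt x₀ y t)) (conePt x₀ y t)) (v : Fin (n + 1) → E) :
    HasDerivAt (fun s => ω (conePt x₀ y s) v) (ω' (conePt x₀ y t) (y - x₀) v) t := by
  have h1 : HasDerivAt (fun s => ω (conePt x₀ y s)) (ω' (conePt x₀ y t) (y - x₀)) t :=
    h.comp_hasDerivAt t (hasDerivAt_conePt x₀ y t)
  exact (ContinuousAlternatingMap.apply ℝ E F v).hasFDerivAt.comp_hasDerivAt t h1

/-- **`∫₀¹ [tⁿ⁺¹ Dω(x_t)(y-x₀)(v) + (n+1) tⁿ ω(x_t)(v)] dt = ω(y)(v)`** (FTC for `tⁿ⁺¹ ω(x_t)(v)`).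
[folklore] -/
theorem integral_deriv_pow_smul_apply_conePt {ω : E → E [⋀^Fin (n + 1)]→L[ℝ] F}
    {ω' : E → E →L[ℝ] E [⋀^Fin (n + 1)]→L[ℝ] F} {X : Set E} {x₀ y : E} (hX : StarConvex ℝ x₀ X) (hy : y ∈ X)
    (hd : ∀ x ∈ X, HasFDerivAt ω (ω' x) x) (hc : ContinuousOn ω X) (hc' : ContinuousOn ω' X)
    (v : Fin (n + 1) → E) :
    ∫ t in (0 : ℝ)..1, (t ^ (n + 1)) • ω' (conePt x₀ y t) (y - x₀) v + (((n : ℝ) + 1) * t ^ n) • ω (conePt x₀ y t) v =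
      ω y v := by
  have hderiv : ∀ t ∈ uIcc (0 : ℝ) 1, HasDerivAt (fun s : ℝ => (s ^ (n + 1)) • ω (conePt x₀ y s) v)
      ((t ^ (n + 1)) • ω' (conePt x₀ y t) (y - x₀) v + (((n : ℝ) + 1) * t ^ n) • ω (conePt x₀ y t) v) t := by
    intro t ht
    rw [uIcc_of_le zero_le_one] at ht
    have h1 := hasDerivAt_apply_conePt (hd _ (conePt_mem hX hy ht)) v
    have h2 : HasDerivAt (fun s : ℝ => s ^ (n + 1)) (((n : ℝ) + 1) * t ^ n) t := by
      simpa using hasDerivAt_pow (n + 1) t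
    exact h2.smul h1
  have hint : IntervalIntegrable (fun t : ℝ => (t ^ (n + 1)) • ω' (conePt x₀ y t) (y - x₀) v +
      (((n : ℝ) + 1) * t ^ n) • ω (conePt x₀ y t) v) volume 0 1 := by
    refine ContinuousOn.intervalIntegrable ?_
    rw [uIcc_of_le zero_le_one]
    refine ContinuousOn.add ?_ ?_
    · refine (continuousOn_pow (n + 1)).smul ?_
      have h1 : ContinuousOn (fun t => ω' (conePt x₀ y t) (y - x₀)) (Icc 0 1) :=
        (continuousOn_comp_conePt hc' hX hy).clm_apply continuousOn_const
      exact (ContinuousAlternatingMap.apply ℝ E F v).continuous.comp_continuousOn h1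
    · exact (continuousOn_const.mul (continuousOn_pow n)).smul
        (((ContinuousAlternatingMap.apply ℝ E F v).continuous.comp_continuousOn (continuousOn_comp_conePt hc hX hy)))
  rw [integral_eq_sub_of_hasDerivAt hderiv hint]
  simp

/-! ### Differentiation under the integral sign -/

/-- The derivative integrand of the cone operator at the parameter `y'` and time `t`:
`w ↦ tⁿ · (ω(x_t)(w, …) + t · Dω(x_t)(w)(y' - x₀, …))`, written through the bilinear map
`(f, u) ↦ f.curryLeft u` (`ContinuousLinearMap.hasFDerivAt_of_bilinear`). [folklore] -/
def coneDerivIntegrand (x₀ : E) (ω : E → E [⋀^Fin (n + 1)]→L[ℝ] F) (ω' : E → E →L[ℝ] E [⋀^Fin (n + 1)]→L[ℝ] F)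
    (y' : E) (t : ℝ) : E →L[ℝ] E [⋀^Fin n]→L[ℝ] F :=
  (t ^ n) • ((curryLeftCLM F n).precompR E (ω (conePt x₀ y' t)) (ContinuousLinearMap.id ℝ E) +
    (curryLeftCLM F n).precompL E ((ω' (conePt x₀ y' t)).comp (t • ContinuousLinearMap.id ℝ E)) (y' - x₀))

omit [CompleteSpace F] in
/-- The derivative integrand, evaluated: `tⁿ · (ω(x_t).curryLeft w + (t Dω(x_t) w).curryLeft (y' - x₀))`.
[folklore] -/
theorem coneDerivIntegrand_apply (x₀ : E) (ω : E → E [⋀^Fin (n + 1)]→L[ℝ] F)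
    (ω' : E → E →L[ℝ] E [⋀^Fin (n + 1)]→L[ℝ] F) (y' : E) (t : ℝ) (w : E) :
    coneDerivIntegrand x₀ ω ω' y' t w =
      (t ^ n) • ((ω (conePt x₀ y' t)).curryLeft w + (t • ω' (conePt x₀ y' t) w).curryLeft (y' - x₀)) := by
  simp only [coneDerivIntegrand, ContinuousLinearMap.precompR, ContinuousLinearMap.precompL, FunLike.coe_smul,
    FunLike.coe_add, Pi.smul_apply, Pi.add_apply, ContinuousLinearMap.flip_apply, ContinuousLinearMap.comp_apply,
    ContinuousLinearMap.compL_apply, ContinuousLinearMap.id_apply, curryLeftCLM_apply,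
    ContinuousAlternatingMap.curryLeft_smul, map_smul]

omit [CompleteSpace F] in
/-- The derivative integrand, doubly evaluated. [folklore] -/
@[simp] theorem coneDerivIntegrand_apply_apply (x₀ : E) (ω : E → E [⋀^Fin (n + 1)]→L[ℝ] F)
    (ω' : E → E →L[ℝ] E [⋀^Fin (n + 1)]→L[ℝ] F) (y' : E) (t : ℝ) (w : E) (m : Fin n → E) :
    coneDerivIntegrand x₀ ω ω' y' t w m =
      (t ^ n) • (ω (conePt x₀ y' t) (Matrix.vecCons w m) + t • ω' (conePt x₀ y' t) w (Matrix.vecCons (y' - x₀) m)) := by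
  rw [coneDerivIntegrand_apply]
  simp only [ContinuousAlternatingMap.smul_apply, ContinuousAlternatingMap.add_apply,
    ContinuousAlternatingMap.curryLeft_apply_apply, ContinuousAlternatingMap.curryLeft_smul, FunLike.coe_smul,
    Pi.smul_apply]

omit [CompleteSpace F] in
/-- Norm bound for the derivative integrand: `‖F'(y', t)‖ ≤ ‖ω(x_t)‖ + ‖Dω(x_t)‖ ‖y' - x₀‖` for
`t ∈ [0, 1]`. [folklore] -/
theorem norm_coneDerivIntegrand_le (x₀ : E) (ω : E → E [⋀^Fin (n + 1)]→L[ℝ] F)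
    (ω' : E → E →L[ℝ] E [⋀^Fin (n + 1)]→L[ℝ] F) (y' : E) {t : ℝ} (ht : t ∈ Icc (0 : ℝ) 1) :
    ‖coneDerivIntegrand x₀ ω ω' y' t‖ ≤ ‖ω (conePt x₀ y' t)‖ + ‖ω' (conePt x₀ y' t)‖ * ‖y' - x₀‖ := by
  refine ContinuousLinearMap.opNorm_le_bound _ (by positivity) fun w => ?_
  rw [coneDerivIntegrand_apply, norm_smul, norm_pow, Real.norm_eq_abs]
  have ht1 : |t| ^ n ≤ 1 := pow_le_one₀ (abs_nonneg t) (abs_le.2 ⟨by linarith [ht.1], ht.2⟩)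
  have h1 : ‖(ω (conePt x₀ y' t)).curryLeft w‖ ≤ ‖ω (conePt x₀ y' t)‖ * ‖w‖ := norm_curryLeft_apply_le _ _
  have h2 : ‖(t • ω' (conePt x₀ y' t) w).curryLeft (y' - x₀)‖ ≤ ‖ω' (conePt x₀ y' t)‖ * ‖y' - x₀‖ * ‖w‖ := by
    refine (norm_curryLeft_apply_le _ _).trans ?_
    rw [norm_smul, Real.norm_eq_abs]
    have h3 : ‖ω' (conePt x₀ y' t) w‖ ≤ ‖ω' (conePt x₀ y' t)‖ * ‖w‖ := ContinuousLinearMap.le_opNorm _ _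
    have h4 : |t| ≤ 1 := abs_le.2 ⟨by linarith [ht.1], ht.2⟩
    calc |t| * ‖ω' (conePt x₀ y' t) w‖ * ‖y' - x₀‖ ≤ 1 * (‖ω' (conePt x₀ y' t)‖ * ‖w‖) * ‖y' - x₀‖ := by
          gcongr
      _ = ‖ω' (conePt x₀ y' t)‖ * ‖y' - x₀‖ * ‖w‖ := by ring
  calc |t| ^ n * ‖(ω (conePt x₀ y' t)).curryLeft w + (t • ω' (conePt x₀ y' t) w).curryLeft (y' - x₀)‖
      ≤ 1 * (‖ω (conePt x₀ y' t)‖ * ‖w‖ + ‖ω' (conePt x₀ y' t)‖ * ‖y' - x₀‖ * ‖w‖) :=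
        mul_le_mul ht1 ((norm_add_le _ _).trans (add_le_add h1 h2)) (norm_nonneg _) zero_le_one
    _ = (‖ω (conePt x₀ y' t)‖ + ‖ω' (conePt x₀ y' t)‖ * ‖y' - x₀‖) * ‖w‖ := by ring

set_option maxHeartbeats 800000 in
omit [CompleteSpace F] in
/-- Pointwise derivative of the integrand of the cone operator in the parameter. [folklore] -/
theorem hasFDerivAt_coneIntegrand {ω : E → E [⋀^Fin (n + 1)]→L[ℝ] F} {ω' : E → E →L[ℝ] E [⋀^Fin (n + 1)]→L[ℝ] F}
    {x₀ y' : E} {t : ℝ} (h : HasFDerivAt ω (ω' (conePt x₀ y' t)) (conePt x₀ y' t)) :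
    HasFDerivAt (fun z : E => (t ^ n) • (ω (conePt x₀ z t)).curryLeft (z - x₀)) (coneDerivIntegrand x₀ ω ω' y' t) y' := by
  have h0 : HasFDerivAt (fun z : E => ω (conePt x₀ z t)) ((ω' (conePt x₀ y' t)).comp (t • ContinuousLinearMap.id ℝ E)) y' :=
    HasFDerivAt.comp y' h (hasFDerivAt_conePt_right x₀ t y')
  have hb : HasFDerivAt (fun z : E => z - x₀) (ContinuousLinearMap.id ℝ E) y' := (hasFDerivAt_id y').sub_const x₀
  exact ((curryLeftCLM F n).hasFDerivAt_of_bilinear h0 hb).const_smul (t ^ n)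

omit [CompleteSpace F] in
/-- The derivative integrand as `tⁿ · (ω(x_t).curryLeft + t · curryLeft(·)(y' - x₀) ∘ Dω(x_t))`.
[folklore] -/
theorem coneDerivIntegrand_eq (x₀ : E) (ω : E → E [⋀^Fin (n + 1)]→L[ℝ] F)
    (ω' : E → E →L[ℝ] E [⋀^Fin (n + 1)]→L[ℝ] F) (y' : E) (t : ℝ) :
    coneDerivIntegrand x₀ ω ω' y' t =
      (t ^ n) • (curryLeftCLM F n (ω (conePt x₀ y' t)) +
        t • (((curryLeftCLM F n).flip (y' - x₀)).comp (ω' (conePt x₀ y' t)))) := by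
  ext w m
  rw [coneDerivIntegrand_apply_apply]
  simp only [FunLike.coe_smul, FunLike.coe_add, Pi.smul_apply, Pi.add_apply, ContinuousLinearMap.comp_apply,
    ContinuousLinearMap.flip_apply, curryLeftCLM_apply, ContinuousAlternatingMap.smul_apply,
    ContinuousAlternatingMap.add_apply, ContinuousAlternatingMap.curryLeft_apply_apply, smul_add]

set_option maxHeartbeats 800000 in
omit [CompleteSpace F] in
/-- Continuity of the derivative integrand in `t` along a segment inside the domain. [folklore] -/
theorem continuousOn_coneDerivIntegrand {ω : E → E [⋀^Fin (n + 1)]→L[ℝ] F}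
    {ω' : E → E →L[ℝ] E [⋀^Fin (n + 1)]→L[ℝ] F} {X : Set E} {x₀ y : E} (hX : StarConvex ℝ x₀ X) (hy : y ∈ X)
    (hc : ContinuousOn ω X) (hc' : ContinuousOn ω' X) :
    ContinuousOn (fun t : ℝ => coneDerivIntegrand x₀ ω ω' y t) (Icc 0 1) := by
  have e : (fun t : ℝ => coneDerivIntegrand x₀ ω ω' y t) = fun t : ℝ => (t ^ n) • (curryLeftCLM F n (ω (conePt x₀ y t)) +
      t • (((curryLeftCLM F n).flip (y - x₀)).comp (ω' (conePt x₀ y t)))) :=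
    funext fun t => coneDerivIntegrand_eq x₀ ω ω' y t
  rw [e]
  refine (continuousOn_pow n).smul (ContinuousOn.add ?_ ?_)
  · exact (curryLeftCLM F n).continuous.comp_continuousOn (continuousOn_comp_conePt hc hX hy)
  · exact continuousOn_id.smul (continuousOn_const.clm_comp (continuousOn_comp_conePt hc' hX hy))

omit [CompleteSpace F] in
/-- The space of derivatives `E →L[ℝ] (E [⋀^Fin n]→L[ℝ] F)` is pseudo-metrisable (its uniformity is
the operator-norm one; recorded explicitly for measurability statements). [folklore] -/
theorem pseudoMetrizableSpace_clm_alternating :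
    TopologicalSpace.PseudoMetrizableSpace (E →L[ℝ] E [⋀^Fin n]→L[ℝ] F) :=
  @UniformSpace.pseudoMetrizableSpace (E →L[ℝ] E [⋀^Fin n]→L[ℝ] F)
    (@PseudoMetricSpace.toUniformSpace (E →L[ℝ] E [⋀^Fin n]→L[ℝ] F) inferInstance)
    (@EMetric.instIsCountablyGeneratedUniformity (E →L[ℝ] E [⋀^Fin n]→L[ℝ] F) inferInstance)

set_option maxHeartbeats 1600000 in
omit [CompleteSpace F] in
/-- **The cone operator is differentiable, with derivative the integral of the derivative of the
integrand**, at every point `y` of an open set `X` star-shaped w.r.t. `x₀` on which `ω` is `C¹`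
(`ω' = Dω` continuous), granted a uniform bound of `ω` and `Dω` on the cones over a ball at `y`
(automatic for finite-dimensional `E`, by compactness). [cite: Spivak1965, Thm. 4-11] -/
theorem hasFDerivAt_conePrimitive {ω : E → E [⋀^Fin (n + 1)]→L[ℝ] F} {ω' : E → E →L[ℝ] E [⋀^Fin (n + 1)]→L[ℝ] F}
    {X : Set E} {x₀ : E} (hX : StarConvex ℝ x₀ X) (hd : ∀ x ∈ X, HasFDerivAt ω (ω' x) x)
    (hc : ContinuousOn ω X) (hc' : ContinuousOn ω' X) {y : E} {r C : ℝ} (hr : 0 < r)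
    (hball : Metric.ball y r ⊆ X)
    (hC : ∀ y' ∈ Metric.ball y r, ∀ t ∈ Icc (0 : ℝ) 1, ‖ω (conePt x₀ y' t)‖ ≤ C ∧ ‖ω' (conePt x₀ y' t)‖ ≤ C) :
    HasFDerivAt (conePrimitive x₀ ω) (∫ t in (0 : ℝ)..1, coneDerivIntegrand x₀ ω ω' y t) y := by
  haveI : TopologicalSpace.PseudoMetrizableSpace (E →L[ℝ] E [⋀^Fin n]→L[ℝ] F) := pseudoMetrizableSpace_clm_alternating
  have hy : y ∈ X := hball (Metric.mem_ball_self hr)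
  have hyX : ∀ y' ∈ Metric.ball y r, y' ∈ X := fun y' hy' => hball hy'
  -- continuity of the integrands in `t` on `[0, 1]`
  have hFc : ∀ y' ∈ Metric.ball y r,
      ContinuousOn (fun t : ℝ => (t ^ n) • (ω (conePt x₀ y' t)).curryLeft (y' - x₀)) (Icc 0 1) := by
    intro y' hy'
    refine (continuousOn_pow n).smul ?_
    have h1 : ContinuousOn (fun t => curryLeftCLM F n (ω (conePt x₀ y' t)) (y' - x₀)) (Icc 0 1) :=
      ((curryLeftCLM F n).continuous.comp_continuousOn (continuousOn_comp_conePt hc hX (hyX y' hy'))).clm_apply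
        continuousOn_const
    simpa using h1
  have hF'c : ContinuousOn (fun t : ℝ => coneDerivIntegrand x₀ ω ω' y t) (Icc 0 1) :=
    continuousOn_coneDerivIntegrand hX hy hc hc'
  have hI : Ι (0 : ℝ) 1 = Ioc 0 1 := uIoc_of_le zero_le_one
  refine intervalIntegral.hasFDerivAt_integral_of_dominated_of_fderiv_le (μ := volume)
    (F := fun (y' : E) (t : ℝ) => (t ^ n) • (ω (conePt x₀ y' t)).curryLeft (y' - x₀))
    (F' := fun (y' : E) (t : ℝ) => coneDerivIntegrand x₀ ω ω' y' t) (bound := fun _ => C + C * (‖y - x₀‖ + r))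
    (Metric.ball_mem_nhds y hr) ?_ (intervalIntegrable_conePrimitive hc hX hy) ?_ ?_ intervalIntegrable_const ?_
  · filter_upwards [Metric.ball_mem_nhds y hr] with y' hy'
    rw [hI]
    exact ((hFc y' hy').mono Ioc_subset_Icc_self).aestronglyMeasurable measurableSet_Ioc
  · rw [hI]
    exact (hF'c.mono Ioc_subset_Icc_self).aestronglyMeasurable measurableSet_Ioc
  · refine Filter.Eventually.of_forall fun t ht y' hy' => ?_
    rw [hI] at ht
    have ht' : t ∈ Icc (0 : ℝ) 1 := ⟨ht.1.le, ht.2⟩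
    obtain ⟨hωC, hω'C⟩ := hC y' hy' t ht'
    have h0C : 0 ≤ C := (norm_nonneg _).trans hωC
    have hdist : ‖y' - x₀‖ ≤ ‖y - x₀‖ + r := by
      have h1 : ‖y' - x₀‖ ≤ ‖y' - y‖ + ‖y - x₀‖ := norm_sub_le_norm_sub_add_norm_sub y' y x₀
      have h2 : ‖y' - y‖ < r := by rwa [← dist_eq_norm]
      linarith
    calc ‖coneDerivIntegrand x₀ ω ω' y' t‖
        ≤ ‖ω (conePt x₀ y' t)‖ + ‖ω' (conePt x₀ y' t)‖ * ‖y' - x₀‖ := norm_coneDerivIntegrand_le x₀ ω ω' y' ht'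
      _ ≤ C + C * (‖y - x₀‖ + r) := by
          gcongr
  · refine Filter.Eventually.of_forall fun t ht y' hy' => ?_
    rw [hI] at ht
    exact hasFDerivAt_coneIntegrand (hd _ (conePt_mem hX (hyX y' hy') ⟨ht.1.le, ht.2⟩))

/-- Double evaluation `T ↦ T w m` on `E →L[ℝ] (E [⋀^Fin n]→L[ℝ] F)`, as a continuous linear map. [folklore] -/
def evalCLM (w : E) (m : Fin n → E) : (E →L[ℝ] E [⋀^Fin n]→L[ℝ] F) →L[ℝ] F :=
  (ContinuousAlternatingMap.apply ℝ E F m).comp (ContinuousLinearMap.apply ℝ (E [⋀^Fin n]→L[ℝ] F) w)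

omit [CompleteSpace F] in
/-- Unfolding. [folklore] -/
@[simp] theorem evalCLM_apply (w : E) (m : Fin n → E) (T : E →L[ℝ] E [⋀^Fin n]→L[ℝ] F) :
    evalCLM w m T = T w m := rfl

/-- Evaluation commutes with the interval integral of the derivative integrand. [folklore] -/
theorem integral_coneDerivIntegrand_apply_apply {ω : E → E [⋀^Fin (n + 1)]→L[ℝ] F}
    {ω' : E → E →L[ℝ] E [⋀^Fin (n + 1)]→L[ℝ] F} {X : Set E} {x₀ y : E} (hX : StarConvex ℝ x₀ X) (hy : y ∈ X)
    (hc : ContinuousOn ω X) (hc' : ContinuousOn ω' X) (w : E) (m : Fin n → E) :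
    (∫ t in (0 : ℝ)..1, coneDerivIntegrand x₀ ω ω' y t) w m = ∫ t in (0 : ℝ)..1, coneDerivIntegrand x₀ ω ω' y t w m := by
  -- all instance paths pinned to the operator-norm structure of `E →L[ℝ] (E [⋀^Fin n]→L[ℝ] F)`
  have hint := ContinuousOn.intervalIntegrable (E := E →L[ℝ] E [⋀^Fin n]→L[ℝ] F) (μ := volume) (a := (0 : ℝ)) (b := 1)
    (u := fun t : ℝ => coneDerivIntegrand x₀ ω ω' y t)
    (by rw [uIcc_of_le zero_le_one]; exact continuousOn_coneDerivIntegrand hX hy hc hc')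
  have h := ContinuousLinearMap.intervalIntegral_comp_comm (𝕜 := ℝ) (E := E →L[ℝ] E [⋀^Fin n]→L[ℝ] F) (F := F)
    (μ := volume) (a := (0 : ℝ)) (b := 1) (evalCLM (E := E) (F := F) w m) hint
  exact h.symm

omit [NormedSpace ℝ F] [CompleteSpace F] in
/-- Interval integrability of pointwise finite sums (Mathlib's `IntervalIntegrable.sum`, pointwise form).
[folklore] -/
private theorem intervalIntegrable_sum_apply {ι : Type*} (s : Finset ι) {f : ι → ℝ → F}
    (h : ∀ i ∈ s, IntervalIntegrable (f i) volume 0 1) :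
    IntervalIntegrable (fun t => ∑ i ∈ s, f i t) volume 0 1 := by
  have h1 := IntervalIntegrable.sum s h
  rwa [Finset.sum_fn] at h1

/-! ### The homotopy formula -/

omit [CompleteSpace F] in
/-- `extDeriv ω` is continuous on `X` when `Dω = ω'` is. [folklore] -/
theorem continuousOn_extDeriv {ω : E → E [⋀^Fin (n + 1)]→L[ℝ] F} {ω' : E → E →L[ℝ] E [⋀^Fin (n + 1)]→L[ℝ] F}
    {X : Set E} (hd : ∀ x ∈ X, HasFDerivAt ω (ω' x) x) (hc' : ContinuousOn ω' X) :
    ContinuousOn (extDeriv ω) X := by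
  have h : ContinuousOn (fun x => ContinuousAlternatingMap.alternatizeUncurryFinCLM ℝ E F (ω' x)) X :=
    (ContinuousAlternatingMap.alternatizeUncurryFinCLM ℝ E F).continuous.comp_continuousOn hc'
  refine h.congr fun x hx => ?_
  rw [extDeriv, (hd x hx).fderiv]
  rfl

omit [CompleteSpace F] in
/-- The pointwise algebra of the homotopy formula. [folklore] -/
private theorem integrand_identity (f : E [⋀^Fin (n + 1)]→L[ℝ] F) (B : Fin (n + 1) → F) (D : F) (t : ℝ)
    (v : Fin (n + 1) → E) :
    (∑ i : Fin (n + 1), (-1 : ℝ) ^ (i : ℕ) • ((t ^ n) • (f (Matrix.vecCons (v i) (i.removeNth v)) + t • B i))) +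
        (t ^ (n + 1)) • (D - ∑ i : Fin (n + 1), (-1 : ℝ) ^ (i : ℕ) • B i) =
      (t ^ (n + 1)) • D + (((n : ℝ) + 1) * t ^ n) • f v := by
  have h1 : (∑ i : Fin (n + 1), (-1 : ℝ) ^ (i : ℕ) • ((t ^ n) • (f (Matrix.vecCons (v i) (i.removeNth v)) + t • B i))) =
      (t ^ n) • (∑ i : Fin (n + 1), (-1 : ℝ) ^ (i : ℕ) • f (Matrix.vecCons (v i) (i.removeNth v))) +
        (t ^ (n + 1)) • ∑ i : Fin (n + 1), (-1 : ℝ) ^ (i : ℕ) • B i := by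
    rw [Finset.smul_sum, Finset.smul_sum, ← Finset.sum_add_distrib]
    refine Finset.sum_congr rfl fun i _ => ?_
    rw [smul_add, smul_add, smul_comm ((-1 : ℝ) ^ (i : ℕ)) (t ^ n),
      smul_comm ((-1 : ℝ) ^ (i : ℕ)) (t ^ n) (t • B i), smul_comm ((-1 : ℝ) ^ (i : ℕ)) t (B i),
      smul_smul (t ^ n) t, ← pow_succ]
  rw [h1, sum_negOnePow_smul_map_vecCons_removeNth, smul_sub, smul_smul, mul_comm (t ^ n)]
  abel

set_option maxHeartbeats 1600000 in
/-- **The cone homotopy formula `d(hω) + h(dω) = ω`** at a point `y` of an open set `X`, star-shaped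
with respect to `x₀`, for a form `ω` of class `C¹` on `X` (`Dω = ω'` on `X`, both continuous on
`X`), granted the local bound of `hasFDerivAt_conePrimitive`. [cite: Spivak1965, Thm. 4-11]
[cite: BottTu1982, I §4] -/
theorem extDeriv_conePrimitive_add_conePrimitive_extDeriv_apply
    {ω : E → E [⋀^Fin (n + 1)]→L[ℝ] F} {ω' : E → E →L[ℝ] E [⋀^Fin (n + 1)]→L[ℝ] F}
    {X : Set E} {x₀ : E} (hX : StarConvex ℝ x₀ X) (hd : ∀ x ∈ X, HasFDerivAt ω (ω' x) x)
    (hc : ContinuousOn ω X) (hc' : ContinuousOn ω' X) {y : E} {r C : ℝ} (hr : 0 < r)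
    (hball : Metric.ball y r ⊆ X)
    (hC : ∀ y' ∈ Metric.ball y r, ∀ t ∈ Icc (0 : ℝ) 1, ‖ω (conePt x₀ y' t)‖ ≤ C ∧ ‖ω' (conePt x₀ y' t)‖ ≤ C)
    (v : Fin (n + 1) → E) :
    extDeriv (conePrimitive x₀ ω) y v + conePrimitive x₀ (extDeriv ω) y v = ω y v := by
  have hy : y ∈ X := hball (Metric.mem_ball_self hr)
  have hD := hasFDerivAt_conePrimitive hX hd hc hc' hr hball hC
  set u : E := y - x₀ with hu
  -- the integrands
  set fA : Fin (n + 1) → ℝ → F := fun i t =>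
    (-1 : ℝ) ^ (i : ℕ) • ((t ^ n) • (ω (conePt x₀ y t) (Matrix.vecCons (v i) (i.removeNth v)) +
      t • ω' (conePt x₀ y t) (v i) (Matrix.vecCons u (i.removeNth v)))) with hfA
  set fB : ℝ → F := fun t => (t ^ (n + 1)) • (ω' (conePt x₀ y t) u v -
    ∑ i : Fin (n + 1), (-1 : ℝ) ^ (i : ℕ) • ω' (conePt x₀ y t) (v i) (Matrix.vecCons u (i.removeNth v))) with hfB
  -- continuity, hence integrability, of the integrands
  have hcI : ContinuousOn (fun t : ℝ => coneDerivIntegrand x₀ ω ω' y t) (Icc 0 1) :=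
    continuousOn_coneDerivIntegrand hX hy hc hc'
  have hcA : ∀ i, ContinuousOn (fA i) (Icc 0 1) := by
    intro i
    have h1 : ContinuousOn (fun t : ℝ => coneDerivIntegrand x₀ ω ω' y t (v i) (i.removeNth v)) (Icc 0 1) :=
      (ContinuousAlternatingMap.apply ℝ E F (i.removeNth v)).continuous.comp_continuousOn
        (hcI.clm_apply continuousOn_const)
    have h2 : (fA i) = fun t : ℝ => (-1 : ℝ) ^ (i : ℕ) • coneDerivIntegrand x₀ ω ω' y t (v i) (i.removeNth v) := by
      funext t
      rw [hfA, coneDerivIntegrand_apply_apply]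
    rw [h2]
    exact continuousOn_const.smul h1
  have hω'c : ∀ (w : E) (m : Fin (n + 1) → E), ContinuousOn (fun t : ℝ => ω' (conePt x₀ y t) w m) (Icc 0 1) :=
    fun w m => (ContinuousAlternatingMap.apply ℝ E F m).continuous.comp_continuousOn
      ((continuousOn_comp_conePt hc' hX hy).clm_apply continuousOn_const)
  have hcB : ContinuousOn fB (Icc 0 1) := by
    rw [hfB]
    refine (continuousOn_pow (n + 1)).smul ((hω'c u v).sub ?_)
    exact continuousOn_finsetSum _ fun i _ => continuousOn_const.smul (hω'c (v i) _)
  have hiA : ∀ i ∈ (Finset.univ : Finset (Fin (n + 1))), IntervalIntegrable (fA i) volume 0 1 := fun i _ =>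
    ContinuousOn.intervalIntegrable (by rw [uIcc_of_le zero_le_one]; exact hcA i)
  have hiB : IntervalIntegrable fB volume 0 1 :=
    ContinuousOn.intervalIntegrable (by rw [uIcc_of_le zero_le_one]; exact hcB)
  -- (1) the exterior derivative of the cone operator
  have e1 : extDeriv (conePrimitive x₀ ω) y v = ∫ t in (0 : ℝ)..1, ∑ i : Fin (n + 1), fA i t := by
    rw [extDeriv, hD.fderiv, ContinuousAlternatingMap.alternatizeUncurryFin_apply, integral_finsetSum hiA]
    refine Finset.sum_congr rfl fun i _ => ?_
    rw [negOnePow_zsmul_eq]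
    have h3 := integral_coneDerivIntegrand_apply_apply hX hy hc hc' (v i) (i.removeNth v)
    rw [h3, ← intervalIntegral.integral_smul]
    refine integral_congr fun t _ => ?_
    rw [hfA, coneDerivIntegrand_apply_apply]
  -- (2) the cone operator of the exterior derivative
  have e2 : conePrimitive x₀ (extDeriv ω) y v = ∫ t in (0 : ℝ)..1, fB t := by
    rw [conePrimitive_apply (continuousOn_extDeriv hd hc') hX hy]
    refine integral_congr fun t ht => ?_
    rw [uIcc_of_le zero_le_one] at ht
    rw [hfB, extDeriv_apply_vecCons (hd _ (conePt_mem hX hy ht))]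
  -- (3) combine and integrate `d/dt [tⁿ⁺¹ ω(x_t)(v)]`
  rw [e1, e2, ← integral_add (intervalIntegrable_sum_apply Finset.univ hiA) hiB,
    ← integral_deriv_pow_smul_apply_conePt hX hy hd hc hc' v]
  refine integral_congr fun t _ => ?_
  simp only [hfA, hfB]
  exact integrand_identity (ω (conePt x₀ y t)) (fun i => ω' (conePt x₀ y t) (v i) (Matrix.vecCons u (i.removeNth v)))
    (ω' (conePt x₀ y t) u v) t v

/-- **Poincaré lemma with the cone primitive**: a CLOSED `C¹` form on an open set star-shaped with
respect to `x₀` is exact, `ω = d(h ω)`, pointwise at every point carrying the local bound of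
`hasFDerivAt_conePrimitive`. [cite: Spivak1965, Thm. 4-11] -/
theorem extDeriv_conePrimitive_of_closed
    {ω : E → E [⋀^Fin (n + 1)]→L[ℝ] F} {ω' : E → E →L[ℝ] E [⋀^Fin (n + 1)]→L[ℝ] F}
    {X : Set E} {x₀ : E} (hX : StarConvex ℝ x₀ X) (hd : ∀ x ∈ X, HasFDerivAt ω (ω' x) x)
    (hc : ContinuousOn ω X) (hc' : ContinuousOn ω' X) (hclosed : ∀ x ∈ X, extDeriv ω x = 0)
    {y : E} {r C : ℝ} (hr : 0 < r) (hball : Metric.ball y r ⊆ X)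
    (hC : ∀ y' ∈ Metric.ball y r, ∀ t ∈ Icc (0 : ℝ) 1, ‖ω (conePt x₀ y' t)‖ ≤ C ∧ ‖ω' (conePt x₀ y' t)‖ ≤ C) :
    extDeriv (conePrimitive x₀ ω) y = ω y := by
  ext v
  have h := extDeriv_conePrimitive_add_conePrimitive_extDeriv_apply hX hd hc hc' hr hball hC v
  have hy : y ∈ X := hball (Metric.mem_ball_self hr)
  have h0 : conePrimitive x₀ (extDeriv ω) y v = 0 := by
    rw [conePrimitive_apply (continuousOn_extDeriv hd hc') hX hy]
    refine (integral_congr (g := fun _ => (0 : F)) fun t ht => ?_).trans (by simp)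
    rw [uIcc_of_le zero_le_one] at ht
    simp [hclosed _ (conePt_mem hX hy ht)]
  rwa [h0, add_zero] at h

end Literature.Analysis.Calculus

end
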